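import Summits.BirchSwinnertonDyer.BirchSwinnertonDyer.Theorems.AdditiveKolyvaginRoadLocalPackageOfPerfSupply
import Summits.BirchSwinnertonDyer.BirchSwinnertonDyer.Theorems.AdditiveKolyvaginRoadKolyvaginPerf
import HarnessLib

/-!
# Route `AdditiveKolyvaginRoad`, crux `KolyvaginPrimitiveAdditive` (item stmt-BirchSwinnertonDyer-20132):
# stub LOC REDUCED TO (Supply) ALONE at a general odd prime `p` — the local–global package of W. Zhang's induction from
# W. Zhang's Lemma 8.2 only
# (cell `pub/bsd-wall`, lead prover `bsd-wall-akr-p1` g3; `--supports stmt-BirchSwinnertonDyer-20132`, helper)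

WHY THIS FILE. One theorem recording WHAT IS LEFT of stub LOC `stub_kolyvaginLocalPackageAdditive` of skeleton v8 of crux
20132 after this seat's reductions: at a ♯-type frame (`K` imaginary quadratic, `p` odd, `ρ̄_{E,p}` onto, `c ≠ 1`),
`Nonempty (KolyvaginLocalPackageP W K p ι c)` follows from (Supply) ALONE — W. Zhang's Lemma 8.2 for the level structure
(E-side; Poitou–Tate Euler characteristic; at `p = 3` being formalised in cell bsd-stepL, `…ZhangSupply*`). Everything else
is tree mathematics at every odd prime: `b = inv ∘ ∪ₑ`, (REC), Kummer ∕ TORIC isotropy (p533303), (Tr-iso) (p535599),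
(Line) (p538019), (Perf) (`…KolyvaginPerf`, with `…PerfLocal` p537706, `…PerfCore` p538972, bridge p536240).

HONEST FRAMING: one theorem; 0 definitions, 0 named facts, 0 `sorry`; CONDITIONAL on (Supply); does NOT close stub LOC.

References: [cite: WZhang2014, §8.1, Lemma 8.1, Lemma 8.2, Lemma 8.4] [cite: GrossLMS1991, Prop. 8.1, Prop. 8.2, Prop. 9.6]
[cite: MilneADT2006, Ch. I, Cor. 2.3, Thm. 4.10].
-/

-- single-conjunct summit: `Summit.BirchSwinnertonDyer.BirchSwinnertonDyer.…` repeats the name by design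
set_option linter.dupNamespace false

noncomputable section

open scoped Classical

namespace Summit.BirchSwinnertonDyer.BirchSwinnertonDyer.Theorems.AdditiveKoly

open CategoryTheory WeierstrassCurve NumberField IsDedekindDomain Field
  Literature.NumberTheory.EllipticCurves Literature.NumberTheory.EllipticCurves.ModularForms
  Literature.NumberTheory.GaloisRepresentations Module
open Literature.NumberTheory.GaloisCohomology
open scoped ContRepresentation

variable (W : WeierstrassCurve ℚ) (K : Type) [Field K] [NumberField K] (p : ℕ)
variable [W.IsElliptic] [W.IsGloballyMinimal] [Fact p.Prime] (ι : K →+* ℂ) (c : K ≃ₐ[ℚ] K)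
  [∀ v : Place K, Module (ZMod p)
    (galoisCohomology (((W.baseChange K).torsionGaloisModule ((p ^ 1 : ℕ) : ℤ)).toLocal v) 1)]
  [∀ v : Place K, CompactSpace (absoluteGaloisGroup (Place.Completion v))]
  [Finite (geomTorsion (W.baseChange K) ((p ^ 1 : ℕ) : ℤ))]

/-- **Stub LOC of crux 20132 from (Supply) ALONE**, at a ♯-type frame (`K` imaginary quadratic, `p` odd, `ρ̄_{E,p}` onto,
`c ≠ 1`): `kolyvaginLocalPackageP_of_perf_of_supply` fed with (Perf) `cupProduct_ne_zero_of_selmer_of_transverse_P`. What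
remains is W. Zhang's Lemma 8.2 for the level-`n` structure (verbatim the field `KolyvaginLocalPackageP.supply`).
[cite: WZhang2014, Lemma 8.2, Lemma 8.4] [cite: GrossLMS1991, Prop. 8.1, Prop. 9.6] -/
theorem kolyvaginLocalPackageP_of_supply (hK : IsImaginaryQuadratic K) (hp2 : p ≠ 2)
    (hsurj : W.HasSurjectiveModNGaloisRep p) (hc : c ≠ 1)
    -- (Supply): Zhang's Lemma 8.2 for the level-n structure (verbatim the field `supply`)
    (hSupply : ∀ (n : Finset (AdmQ W K p)), n.Nonempty →
      ∀ (ℓ : {ℓ // Zhang2014.IsKolyvaginPrime (W.conductorNorm ℤ) W K p ℓ})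
        (T : Finset {ℓ // Zhang2014.IsKolyvaginPrime (W.conductorNorm ℤ) W K p ℓ}), ℓ ∉ T →
      ∀ s : Bool, ∃ x : Vp W K p, conjAct W c ((p ^ 1 : ℕ) : ℤ) x = sgnP s • x ∧ x ≠ 0 ∧
        (∀ w : InfinitePlace K, x ∈ selmerLocalKer (W.baseChange K) w.Completion ((p ^ 1 : ℕ) : ℤ)) ∧
        (∀ v : HeightOneSpectrum (𝓞 K), ((ℓ : ℕ) : 𝓞 K) ∉ v.asIdeal →
          (∀ ℓ' ∈ T, ((ℓ' : ℕ) : 𝓞 K) ∉ v.asIdeal) →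
          ((∀ q ∈ n, ((q : ℕ) : 𝓞 K) ∉ v.asIdeal) →
            x ∈ selmerLocalKer (W.baseChange K) (v.adicCompletion K) ((p ^ 1 : ℕ) : ℤ)) ∧
          (∀ q ∈ n, ((q : ℕ) : 𝓞 K) ∈ v.asIdeal →
            x ∈ toricLocalKer (W.baseChange K) (v.adicCompletion K) ((p ^ 1 : ℕ) : ℤ))) ∧
        (∀ ℓ' ∈ T, ∀ v : HeightOneSpectrum (𝓞 K), ((ℓ' : ℕ) : 𝓞 K) ∈ v.asIdeal →
          x ∈ transverseLocalKerP W K p ι ℓ' v)) :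
    Nonempty (KolyvaginLocalPackageP W K p ι c) :=
  kolyvaginLocalPackageP_of_perf_of_supply W K p ι c hK hp2 hsurj hc
    (fun e hμ hadd₁ hadd₂ halt hnondeg hgal _ hℓ v hv s _ _ hxs hys hxK hx0 hyT hy0 ↦
      cupProduct_ne_zero_of_selmer_of_transverse_P W K p hK hp2 hsurj ι hc e hμ hadd₁ hadd₂ halt hnondeg hgal hℓ v hv s
        hxs hys hxK hx0 hyT hy0)
    hSupply

end Summit.BirchSwinnertonDyer.BirchSwinnertonDyer.Theorems.AdditiveKoly

end
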